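import Mathlib.NumberTheory.NumberField.Ideal.Asymptotics
import Mathlib.NumberTheory.NumberField.DedekindZeta
import Literature.NumberTheory.LFunctions.FundamentalConeBoundary
import Literature.NumberTheory.LFunctions.DedekindZetaHalfPlane
import HarnessLib

/-!
# The Weber–Landau ideal count `I_K(x) = ρ_K x + O(x^{1 − 1/d})` (proof)

Topic `Literature/NumberTheory/LFunctions`. Everything in this file is PROVED. It discharges the
named fact `Literature.NumberField.idealCount_sub_residue_mul_le K` of `DedekindZetaHalfPlane.lean`
(Montgomery–Vaughan (8.43), p. 266; Marcus, *Number Fields*, Ch. 6, Theorem 39 and its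
Corollary: `i(t) = hκt + ε(t)`, `ε(t) = O(t^{1−1/n})`) for **every** number field `K`:

* `idealCount_sub_residue_mul_le_holds K : idealCount_sub_residue_mul_le K`.

The proof is Marcus's (Ch. 6, pp. 121–129), run on top of Mathlib's proof of the main term
(`NumberField.Ideal.tendsto_norm_le_div_atTop₀`, X. Roblot): the ideals of norm `≤ s` in
an ideal class `C` correspond, `w_K`-to-one, to the points of the ideal lattice of a fixed
`J ∈ C⁻¹` in the fundamental cone with norm `≤ s·N(J)` (Mathlib's
`card_isPrincipal_dvd_norm_le`); these
are counted by the lattice-point theorem with Lipschitz boundary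
(`Literature.Algebra.EuclideanLattices.abs_card_sep_le_sub_le`, Marcus Lemma 2, file
`Algebra/EuclideanLattices/LatticePointCounting.lean`), whose boundary hypothesis for
`normLeOne K` is `Literature.NumberTheory.LFunctions.NumberField.lipschitzFrontier_normLeOne`
(`FundamentalConeBoundary.lean`, Marcus pp. 127–129). Summing over the finitely many classes
gives `I_K(s) = A s + O(s^{1−1/d})` for some constant `A`; comparing with Mathlib's limit
`I_K(s)/s → ρ_K` identifies `A = ρ_K = dedekindZeta_residue K` (so Mathlib's volume
computation is reused, not redone).

## References

* D. A. Marcus, *Number Fields*, 2nd ed., Universitext, Springer 2018, Ch. 6, Theorem 39,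
  its Corollary, and Lemma 2 (`Marcus2018`).
* H. L. Montgomery, R. C. Vaughan, *Multiplicative Number Theory I*, CUP 2007, (8.43) p. 266
  (`MontgomeryVaughan2007`).
-/

noncomputable section

open NumberField NumberField.InfinitePlace NumberField.mixedEmbedding
  NumberField.mixedEmbedding.fundamentalCone NumberField.Units Ideal Filter Topology Set
  MeasureTheory Bornology
open scoped nonZeroDivisors Real

namespace Literature.NumberTheory.LFunctions.NumberField

variable (K : Type*) [Field K] [NumberField K]

/-! ## One ideal class -/

variable {K} in
/-- Ideals of norm `≤ s` in the class `C` correspond to principal ideals divisible by a fixed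
`J ∈ C⁻¹` of norm `≤ s N(J)` (Marcus p. 121; this is Mathlib's private
`tendsto_norm_le_and_mk_eq_div_atTop_aux₁`, reproduced). [cite: Marcus2018, Ch. 6, proof of Theorem 39] -/
theorem card_norm_le_and_mk_eq {C : ClassGroup (𝓞 K)} {J : (Ideal (𝓞 K))⁰}
    (hJ : ClassGroup.mk0 J = C⁻¹) (s : ℝ) :
    Nat.card {I : (Ideal (𝓞 K))⁰ // absNorm (I : Ideal (𝓞 K)) ≤ s ∧ ClassGroup.mk0 I = C}
      = Nat.card {I : (Ideal (𝓞 K))⁰ // (J : Ideal (𝓞 K)) ∣ I ∧ Submodule.IsPrincipal (I : Ideal (𝓞 K)) ∧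
        absNorm (I : Ideal (𝓞 K)) ≤ s * absNorm (J : Ideal (𝓞 K))} := by
  simp_rw [← nonZeroDivisors_dvd_iff_dvd_coe]
  refine Nat.card_congr ?_
  refine ((Equiv.dvd J).subtypeEquiv fun I ↦ ?_).trans
    (Equiv.subtypeSubtypeEquivSubtypeInter (fun I : (Ideal (𝓞 K))⁰ ↦ J ∣ I) _)
  rw [← ClassGroup.mk0_eq_one_iff (SetLike.coe_mem _)]
  simp_rw [Equiv.dvd_apply, Submonoid.coe_mul, ← Submonoid.mul_def, _root_.map_mul, hJ,
    inv_mul_eq_one, Nat.cast_mul, mul_comm s, eq_comm, and_comm, and_congr_left_iff]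
  exact fun _ ↦
    (mul_le_mul_iff_of_pos_left (Nat.cast_pos.mpr (absNorm_pos_of_nonZeroDivisors J))).symm

variable {K} in
/-- Points of `idealSet K J` of norm `≤ s` are the lattice points of the ideal lattice of `J` in
`{x ∈ fundamentalCone K | N x ≤ s}`. [folklore] -/
theorem card_idealSet_norm_le (J : (Ideal (𝓞 K))⁰) (s : ℝ) :
    Nat.card {a : idealSet K J // mixedEmbedding.norm (a : mixedSpace K) ≤ s} =
      Nat.card ({x ∈ fundamentalCone K | mixedEmbedding.norm x ≤ s} ∩
        (mixedEmbedding.idealLattice K (FractionalIdeal.mk0 K J) : Set (mixedSpace K)) :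
          Set (mixedSpace K)) := by
  refine Nat.card_congr ((Equiv.subtypeSubtypeEquivSubtypeInter
    (fun x : mixedSpace K ↦ x ∈ idealSet K J) (fun x ↦ mixedEmbedding.norm x ≤ s)).trans
    (Equiv.subtypeEquivRight fun x ↦ ?_))
  simp only [idealSet, Set.mem_inter_iff, Set.mem_sep_iff, SetLike.mem_coe]
  tauto

/-- `{x ∈ fundamentalCone K | N x ≤ 1} = normLeOne K`. [folklore] -/
theorem sep_fundamentalCone_norm_le_one :
    {x ∈ fundamentalCone K | mixedEmbedding.norm x ≤ 1} = normLeOne K := by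
  ext; simp

/-- **Lattice-point count in one class with error term** (Marcus, Theorem 39: "`i_C(t) = κt +
ε(t)` where the error `ε(t)` is `O(t^{1−1/n})`"): for every ideal class `C` there are `A, B`
with `|#{I ∈ C : N(I) ≤ s} − A s| ≤ B s^{1 − 1/d}` for `s ≥ 1`. [cite: Marcus2018, Ch. 6, Theorem 39] -/
theorem abs_card_norm_le_and_mk_eq_sub_le (C : ClassGroup (𝓞 K)) :
    ∃ A B : ℝ, ∀ s : ℝ, 1 ≤ s →
      |(Nat.card {I : (Ideal (𝓞 K))⁰ //
          absNorm (I : Ideal (𝓞 K)) ≤ s ∧ ClassGroup.mk0 I = C} : ℝ) - A * s| ≤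
        B * s ^ (1 - 1 / (Module.finrank ℚ K : ℝ)) := by
  classical
  obtain ⟨J, hJ⟩ := ClassGroup.mk0_surjective C⁻¹
  set L : Submodule ℤ (mixedSpace K) := mixedEmbedding.idealLattice K (FractionalIdeal.mk0 K J)
    with hL
  -- the lattice-point theorem for the cone
  have hX : ∀ ⦃x : mixedSpace K⦄ ⦃r : ℝ⦄, x ∈ fundamentalCone K → 0 < r →
      r • x ∈ fundamentalCone K := fun x r hx hr ↦ smul_mem_of_mem hx hr.ne'
  have hF : ∀ (x : mixedSpace K) ⦃r : ℝ⦄, 0 ≤ r →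
      mixedEmbedding.norm (r • x) = r ^ Module.finrank ℝ (mixedSpace K) * mixedEmbedding.norm x := by
    intro x r hr
    rw [mixedEmbedding.norm_smul, abs_of_nonneg hr, mixedEmbedding.finrank]
  have h₁ : IsBounded {x ∈ fundamentalCone K | mixedEmbedding.norm x ≤ 1} := by
    rw [sep_fundamentalCone_norm_le_one]; exact isBounded_normLeOne K
  have h₂ : Literature.Algebra.EuclideanLattices.LipschitzFrontier {x ∈ fundamentalCone K | mixedEmbedding.norm x ≤ 1} := by
    rw [sep_fundamentalCone_norm_le_one]; exact lipschitzFrontier_normLeOne K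
  obtain ⟨C₁, hC₁⟩ := Literature.Algebra.EuclideanLattices.abs_card_sep_le_sub_le volume L hX hF h₁ h₂
  rw [mixedEmbedding.finrank] at hC₁
  set d : ℕ := Module.finrank ℚ K with hd
  set e : ℝ := 1 - 1 / (d : ℝ) with he
  set A₀ : ℝ := volume.real {x ∈ fundamentalCone K | mixedEmbedding.norm x ≤ 1} /
    ZLattice.covolume L volume with hA₀
  set NJ : ℝ := (absNorm (J : Ideal (𝓞 K)) : ℝ) with hNJ
  have hNJ1 : 1 ≤ NJ := by
    rw [hNJ]; exact_mod_cast Nat.one_le_iff_ne_zero.2 (absNorm_ne_zero_of_nonZeroDivisors J)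
  have hNJ0 : 0 < NJ := by linarith
  set w : ℝ := (torsionOrder K : ℝ) with hw
  have hw0 : 0 < w := by rw [hw]; exact_mod_cast torsionOrder_pos K
  have he0 : 0 ≤ e := by
    rw [he, sub_nonneg, div_le_one (by exact_mod_cast Module.finrank_pos)]
    exact_mod_cast Module.finrank_pos
  refine ⟨A₀ * NJ / w, C₁ * NJ ^ e / w, fun s hs ↦ ?_⟩
  have hs0 : 0 ≤ s := by linarith
  -- `w · N_C(s) = #(lattice points of norm ≤ s N(J))`
  have hcount : (Nat.card {I : (Ideal (𝓞 K))⁰ //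
      absNorm (I : Ideal (𝓞 K)) ≤ s ∧ ClassGroup.mk0 I = C} : ℝ) * w =
      Nat.card ({x ∈ fundamentalCone K | mixedEmbedding.norm x ≤ s * NJ} ∩ (L : Set (mixedSpace K)) :
        Set (mixedSpace K)) := by
    rw [card_norm_le_and_mk_eq hJ s, hw, ← Nat.cast_mul, card_isPrincipal_dvd_norm_le,
      card_idealSet_norm_le]
  have hc : 1 ≤ s * NJ := by nlinarith
  have hmain := hC₁ (s * NJ) hc
  rw [← hcount] at hmain
  -- divide by `w`
  have key : |(Nat.card {I : (Ideal (𝓞 K))⁰ //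
      absNorm (I : Ideal (𝓞 K)) ≤ s ∧ ClassGroup.mk0 I = C} : ℝ) - A₀ * NJ / w * s| * w ≤
      (C₁ * NJ ^ e / w * s ^ e) * w := by
    have h1 : |(Nat.card {I : (Ideal (𝓞 K))⁰ //
        absNorm (I : Ideal (𝓞 K)) ≤ s ∧ ClassGroup.mk0 I = C} : ℝ) - A₀ * NJ / w * s| * w =
        |((Nat.card {I : (Ideal (𝓞 K))⁰ //
          absNorm (I : Ideal (𝓞 K)) ≤ s ∧ ClassGroup.mk0 I = C} : ℝ) - A₀ * NJ / w * s) * w| := by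
      rw [abs_mul, abs_of_pos hw0]
    have h2 : ((Nat.card {I : (Ideal (𝓞 K))⁰ //
        absNorm (I : Ideal (𝓞 K)) ≤ s ∧ ClassGroup.mk0 I = C} : ℝ) - A₀ * NJ / w * s) * w =
        (Nat.card {I : (Ideal (𝓞 K))⁰ //
          absNorm (I : Ideal (𝓞 K)) ≤ s ∧ ClassGroup.mk0 I = C} : ℝ) * w - A₀ * (s * NJ) := by
      field_simp
    have h3 : (C₁ * NJ ^ e / w * s ^ e) * w = C₁ * (s * NJ) ^ e := by
      rw [Real.mul_rpow hs0 hNJ0.le]; field_simp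
    rw [h1, h2, h3]
    exact hmain
  exact le_of_mul_le_mul_right key hw0

/-! ## All classes -/

/-- `I_K(s) = ∑_C #{I ∈ C : N(I) ≤ s}` (as in Mathlib's `tendsto_norm_le_div_atTop₀`).
[folklore] -/
theorem idealCount_eq_sum_card {s : ℝ} (hs : 0 ≤ s) :
    (idealCount K s : ℝ) = ∑ C : ClassGroup (𝓞 K),
      (Nat.card {I : (Ideal (𝓞 K))⁰ //
        absNorm (I : Ideal (𝓞 K)) ≤ s ∧ ClassGroup.mk0 I = C} : ℝ) := by
  classical
  unfold idealCount
  have : Fintype {I : (Ideal (𝓞 K))⁰ // (absNorm (I : Ideal (𝓞 K)) : ℝ) ≤ s} := by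
    simp_rw [← Nat.le_floor_iff hs]
    exact @Fintype.ofFinite _ (finite_setOf_absNorm_le₀ ⌊s⌋₊)
  let e := fun C : ClassGroup (𝓞 K) ↦ Equiv.subtypeSubtypeEquivSubtypeInter
    (fun I : (Ideal (𝓞 K))⁰ ↦ (absNorm I.1 : ℝ) ≤ s) (fun I ↦ ClassGroup.mk0 I = C)
  simp_rw [← Nat.card_congr (e _), Nat.card_eq_fintype_card, Fintype.subtype_card]
  rw [Fintype.card, Finset.card_eq_sum_card_fiberwise (f := fun I ↦ ClassGroup.mk0 I.1)
    (t := Finset.univ) (fun _ _ ↦ Finset.mem_univ _), Nat.cast_sum]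

/-- **Ideal count with error term and some main constant** (Marcus, Corollary to Theorem 39:
"`i(t) = hκt + ε(t)`, `ε(t)` is `O(t^{1−1/n})`"): there are `A, B` with
`|I_K(s) − A s| ≤ B s^{1−1/d}` for `s ≥ 1`. [cite: Marcus2018, Ch. 6, Corollary of Theorem 39] -/
theorem abs_idealCount_sub_le :
    ∃ A B : ℝ, ∀ s : ℝ, 1 ≤ s →
      |(idealCount K s : ℝ) - A * s| ≤ B * s ^ (1 - 1 / (Module.finrank ℚ K : ℝ)) := by
  choose A B hAB using abs_card_norm_le_and_mk_eq_sub_le K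
  refine ⟨∑ C, A C, ∑ C, B C, fun s hs ↦ ?_⟩
  rw [idealCount_eq_sum_card K (by linarith), Finset.sum_mul, ← Finset.sum_sub_distrib,
    Finset.sum_mul]
  exact (Finset.abs_sum_le_sum_abs _ _).trans (Finset.sum_le_sum fun C _ ↦ hAB C s hs)

/-- If `|I_K(s) − A s| ≤ B s^{1−1/d}` for `s ≥ 1` then `I_K(s)/s → A`. [folklore] -/
theorem tendsto_idealCount_div_of_bound {A B : ℝ}
    (h : ∀ s : ℝ, 1 ≤ s → |(idealCount K s : ℝ) - A * s| ≤ B * s ^ (1 - 1 / (Module.finrank ℚ K : ℝ))) :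
    Tendsto (fun s : ℝ ↦ (idealCount K s : ℝ) / s) atTop (𝓝 A) := by
  set d : ℝ := (Module.finrank ℚ K : ℝ) with hd
  have hd0 : 0 < d := by rw [hd]; exact_mod_cast Module.finrank_pos
  have h0 : Tendsto (fun s : ℝ ↦ B * s ^ (-(1 / d))) atTop (𝓝 0) := by
    have := (tendsto_rpow_neg_atTop (y := 1 / d) (by positivity)).const_mul B
    rwa [mul_zero] at this
  have hlo : Tendsto (fun s : ℝ ↦ A - B * s ^ (-(1 / d))) atTop (𝓝 A) := by
    have := h0.const_sub A; rwa [sub_zero] at this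
  have hhi : Tendsto (fun s : ℝ ↦ A + B * s ^ (-(1 / d))) atTop (𝓝 A) := by
    have := h0.const_add A; rwa [add_zero] at this
  have hbd : ∀ s : ℝ, 1 ≤ s → |(idealCount K s : ℝ) / s - A| ≤ B * s ^ (-(1 / d)) := by
    intro s hs
    have hs0 : 0 < s := by linarith
    have h1 := h s hs
    have hrw : (idealCount K s : ℝ) / s - A = ((idealCount K s : ℝ) - A * s) / s := by
      field_simp
    rw [hrw, abs_div, abs_of_pos hs0, div_le_iff₀ hs0]
    calc _ ≤ B * s ^ (1 - 1 / d) := h1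
      _ = B * s ^ (-(1 / d)) * s := by
          rw [mul_assoc, ← Real.rpow_add_one hs0.ne']; ring_nf
  refine tendsto_of_tendsto_of_tendsto_of_le_of_le' hlo hhi ?_ ?_
  · filter_upwards [eventually_ge_atTop 1] with s hs
    have := (abs_le.1 (hbd s hs)).1; linarith
  · filter_upwards [eventually_ge_atTop 1] with s hs
    have := (abs_le.1 (hbd s hs)).2; linarith

/-- **The Weber–Landau ideal count** (discharge of the named fact
`idealCount_sub_residue_mul_le K`, Montgomery–Vaughan (8.43); Marcus Theorem 39 + Corollary,
with the constant identified as `ρ_K = dedekindZeta_residue K` through Mathlib's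
`tendsto_norm_le_div_atTop₀`): for every number field `K` there is `C` with
`|I_K(x) − ρ_K x| ≤ C x^{1 − 1/d}` for all `x ≥ 1`. [cite: MontgomeryVaughan2007, (8.43) p. 266] -/
theorem idealCount_sub_residue_mul_le_holds : idealCount_sub_residue_mul_le K := by
  obtain ⟨A, B, h⟩ := abs_idealCount_sub_le K
  -- Mathlib's main term `I_K(s)/s → ρ_K` (`Ideal.tendsto_norm_le_div_atTop₀`) identifies `A`
  have hmain : Tendsto (fun s : ℝ ↦ (idealCount K s : ℝ) / s) atTop (𝓝 (dedekindZeta_residue K)) := by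
    rw [dedekindZeta_residue_def]
    exact Ideal.tendsto_norm_le_div_atTop₀ K
  have hA : A = dedekindZeta_residue K :=
    tendsto_nhds_unique (tendsto_idealCount_div_of_bound K h) hmain
  refine ⟨B, fun x hx ↦ ?_⟩
  rw [← hA]
  exact h x hx

end Literature.NumberTheory.LFunctions.NumberField
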